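import Summits.ValiantsHypothesis.ValiantsHypothesis.Theorems.BarrierLeverTransversalMinorLayoutsSevenFaces

/-!
# Route BarrierLever — conjecture TT (`TransversalMinorLayoutsNonsingular`, stmt-ValiantsHypothesis-19152):
# seven-face complexes without a vertex of degree two

Helper file (`--supports stmt-ValiantsHypothesis-19152`; cell valiant-natproofs, rung V4, 𝒟-side of
door (c); seat val-np-p1 gen 8).  Companion of `…SevenFaces`: `lowerFamily_seven_no_degree_two` —
a lower family of exactly seven sets, one of which has two elements, in which no element lies in
exactly two members is a TRIANGLE `∅, a, b, c, ab, ac, bc` (membership form).  This is the partner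
of a perfect matching on four coordinates in the locked cell `(4, 7)` of the bounded engine.  Proof:
for a pair member `{a, b}` the elements `a`, `b` have degree `≥ 2`, hence `≥ 3`, so there are
further pairs `{a, c}`, `{b, d}` with their singletons; the three members outside the four subsets
of `{a, b}` cannot accommodate `{a,c}, {b,d}, {c}, {d}` unless `c = d`.

WHAT THIS IS NOT: bookkeeping for bounded-rank slices of TT; nothing on TT / item 19761 in
general, on crux stmt-ValiantsHypothesis-14610, or on `VP` versus `VNP`.
-/

-- layout Summits/ValiantsHypothesis/ValiantsHypothesis forces the duplicated namespace component
set_option linter.dupNamespace false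

open Matrix Finset

namespace Summit.ValiantsHypothesis.ValiantsHypothesis.Theorems.BarrierLever.FiniteCheck

open Summit.ValiantsHypothesis.ValiantsHypothesis.Theorems.BarrierLever.Compression

/-! ## Seven faces with a pair and no vertex of degree two: the triangle -/

/-- A lower family of exactly seven sets, one of which has two elements, in which no element lies
in exactly two members, is a TRIANGLE `{∅, {a}, {b}, {c}, {a,b}, {a,c}, {b,c}}` (membership
form). -/
theorem lowerFamily_seven_no_degree_two {h : ℕ} (F : Finset (Finset (Fin h)))
    (hlow : ∀ x ∈ F, ∀ t, t ⊆ x → t ∈ F) (hF : F.card = 7) (hpair : ∃ x ∈ F, x.card = 2)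
    (hdeg : ∀ c : Fin h, (F.filter fun x => c ∈ x).card ≠ 2) :
    ∃ a b c : Fin h, a ≠ b ∧ a ≠ c ∧ b ≠ c ∧
      ∀ y ∈ F, y = ∅ ∨ y = {a} ∨ y = {b} ∨ y = {c} ∨ y = {a, b} ∨ y = {a, c} ∨ y = {b, c} := by
  classical
  have hle2 := card_le_two_of_mem_lowerFamily F hlow (by omega)
  obtain ⟨x, hxF, hx2⟩ := hpair
  obtain ⟨a, b, hab, rfl⟩ := Finset.card_eq_two.mp hx2
  obtain ⟨hPF, hPcard, hsing⟩ := pair_frame F hlow a b hab hxF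
  set P : Finset (Finset (Fin h)) := {∅, {a}, {b}, {a, b}} with hPdef
  have hPmem : ∀ y, y ∈ P ↔ y = ∅ ∨ y = {a} ∨ y = {b} ∨ y = {a, b} := by
    intro y; simp only [hPdef, Finset.mem_insert, Finset.mem_singleton]
  -- a second pair through each of `a`, `b`
  have hsecond : ∀ v v' : Fin h, v ≠ v' → ({v, v'} : Finset (Fin h)) ∈ F →
      ∃ c : Fin h, c ≠ v ∧ c ≠ v' ∧ ({v, c} : Finset (Fin h)) ∈ F := by
    intro v v' hvv' hvF
    have hvF1 : ({v} : Finset (Fin h)) ∈ F := hlow _ hvF _ (by simp)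
    -- the members containing `v` include `{v}` and `{v, v'}`; their number is not two
    have hsub : ({{v}, {v, v'}} : Finset (Finset (Fin h))) ⊆ F.filter fun x => v ∈ x := by
      intro t ht
      simp only [Finset.mem_insert, Finset.mem_singleton] at ht
      rcases ht with rfl | rfl
      · exact Finset.mem_filter.mpr ⟨hvF1, by simp⟩
      · exact Finset.mem_filter.mpr ⟨hvF, by simp⟩
    have h2 : ({{v}, {v, v'}} : Finset (Finset (Fin h))).card = 2 := by
      rw [Finset.card_pair]
      intro e
      have : v' ∈ ({v} : Finset (Fin h)) := by rw [e]; simp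
      exact hvv' (Finset.mem_singleton.mp this).symm
    have hlt : 2 < (F.filter fun x => v ∈ x).card := by
      have := Finset.card_le_card hsub
      rw [h2] at this
      have hne := hdeg v
      omega
    -- a third member containing `v`
    obtain ⟨y, hy, hyn⟩ : ∃ y ∈ F.filter (fun x => v ∈ x),
        y ∉ ({{v}, {v, v'}} : Finset (Finset (Fin h))) := by
      by_contra hno
      push Not at hno
      have := Finset.card_le_card (show (F.filter fun x => v ∈ x) ⊆ {{v}, {v, v'}} from hno)
      rw [h2] at this
      omega
    rw [Finset.mem_filter] at hy
    obtain ⟨hyF, hvy⟩ := hy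
    simp only [Finset.mem_insert, Finset.mem_singleton, not_or] at hyn
    have hy2 : y.card = 2 := by
      have := hle2 y hyF
      rcases Nat.lt_or_ge y.card 2 with hlt' | hge
      · exfalso
        have hy1 : y.card ≤ 1 := by omega
        exact hyn.1 (Finset.eq_singleton_iff_unique_mem.mpr ⟨hvy, fun e he =>
          Finset.card_le_one.mp hy1 e he v hvy⟩)
      · omega
    obtain ⟨c, hc⟩ := Finset.card_eq_one.mp
      (show (y.erase v).card = 1 by rw [Finset.card_erase_of_mem hvy, hy2])
    have hcy : c ∈ y.erase v := by rw [hc]; simp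
    obtain ⟨hcv, hcy'⟩ := Finset.mem_erase.mp hcy
    have hyeq : y = {v, c} := by rw [← Finset.insert_erase hvy, hc]
    refine ⟨c, hcv, fun e => hyn.2 (by rw [hyeq, e]), hyeq ▸ hyF⟩
  obtain ⟨c, hca, hcb, hacF⟩ := hsecond a b hab hxF
  obtain ⟨d, hdb, hda, hbdF⟩ := hsecond b a hab.symm (by rw [Finset.pair_comm]; exact hxF)
  have hcF : ({c} : Finset (Fin h)) ∈ F := hlow _ hacF _ (by simp)
  have hdF : ({d} : Finset (Fin h)) ∈ F := hlow _ hbdF _ (by simp)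
  -- the outsiders `{a,c}`, `{b,d}`, `{c}`, `{d}` fit into `F \ P` of size three, so `c = d`
  have hdiff : (F \ P).card = 3 := by
    rw [Finset.card_sdiff_of_subset hPF, hF, hPcard]
  have hout_ac : ({a, c} : Finset (Fin h)) ∈ F \ P := by
    rw [Finset.mem_sdiff, hPmem]
    refine ⟨hacF, ?_⟩
    simp only [not_or]
    refine ⟨?_, ?_, ?_, ?_⟩
    · intro e; have : a ∈ (∅ : Finset (Fin h)) := by rw [← e]; simp
      simp at this
    · intro e; have : c ∈ ({a} : Finset (Fin h)) := by rw [← e]; simp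
      exact hca (Finset.mem_singleton.mp this)
    · intro e; have : a ∈ ({b} : Finset (Fin h)) := by rw [← e]; simp
      exact hab (Finset.mem_singleton.mp this)
    · intro e; have : c ∈ ({a, b} : Finset (Fin h)) := by rw [← e]; simp
      simp only [Finset.mem_insert, Finset.mem_singleton] at this
      rcases this with e' | e'
      · exact hca e'
      · exact hcb e'
  have hout_bd : ({b, d} : Finset (Fin h)) ∈ F \ P := by
    rw [Finset.mem_sdiff, hPmem]
    refine ⟨hbdF, ?_⟩
    simp only [not_or]
    refine ⟨?_, ?_, ?_, ?_⟩
    · intro e; have : b ∈ (∅ : Finset (Fin h)) := by rw [← e]; simp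
      simp at this
    · intro e; have : b ∈ ({a} : Finset (Fin h)) := by rw [← e]; simp
      exact hab (Finset.mem_singleton.mp this).symm
    · intro e; have : d ∈ ({b} : Finset (Fin h)) := by rw [← e]; simp
      exact hdb (Finset.mem_singleton.mp this)
    · intro e; have : d ∈ ({a, b} : Finset (Fin h)) := by rw [← e]; simp
      simp only [Finset.mem_insert, Finset.mem_singleton] at this
      rcases this with e' | e'
      · exact hda e'
      · exact hdb e'
  have hout_sing : ∀ e : Fin h, e ≠ a → e ≠ b → ({e} : Finset (Fin h)) ∈ F →
      ({e} : Finset (Fin h)) ∈ F \ P := by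
    intro e hea heb heF
    rw [Finset.mem_sdiff]
    refine ⟨heF, fun hP => ?_⟩
    rcases hsing e hP with e' | e'
    · exact hea e'
    · exact heb e'
  have hcd : c = d := by
    by_contra hcd
    have hsub : ({{a, c}, {b, d}, {c}, {d}} : Finset (Finset (Fin h))) ⊆ F \ P := by
      intro t ht
      simp only [Finset.mem_insert, Finset.mem_singleton] at ht
      rcases ht with rfl | rfl | rfl | rfl
      · exact hout_ac
      · exact hout_bd
      · exact hout_sing c hca hcb hcF
      · exact hout_sing d hda hdb hdF
    have h4 : ({{a, c}, {b, d}, {c}, {d}} : Finset (Finset (Fin h))).card = 4 := by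
      have n1 : ({a, c} : Finset (Fin h)) ∉ ({{b, d}, {c}, {d}} : Finset (Finset (Fin h))) := by
        simp only [Finset.mem_insert, Finset.mem_singleton, not_or]
        refine ⟨fun e => ?_, fun e => ?_, fun e => ?_⟩
        · have : a ∈ ({b, d} : Finset (Fin h)) := by rw [← e]; simp
          simp only [Finset.mem_insert, Finset.mem_singleton] at this
          rcases this with e' | e'
          · exact hab e'
          · exact hda e'.symm
        · have := congrArg Finset.card e
          rw [Finset.card_pair (fun e' => hca e'.symm), Finset.card_singleton] at this; omega
        · have := congrArg Finset.card e
          rw [Finset.card_pair (fun e' => hca e'.symm), Finset.card_singleton] at this; omega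
      have n2 : ({b, d} : Finset (Fin h)) ∉ ({{c}, {d}} : Finset (Finset (Fin h))) := by
        simp only [Finset.mem_insert, Finset.mem_singleton, not_or]
        refine ⟨fun e => ?_, fun e => ?_⟩
        · have := congrArg Finset.card e
          rw [Finset.card_pair (fun e' => hdb e'.symm), Finset.card_singleton] at this; omega
        · have := congrArg Finset.card e
          rw [Finset.card_pair (fun e' => hdb e'.symm), Finset.card_singleton] at this; omega
      have n3 : ({c} : Finset (Fin h)) ≠ {d} := fun e => hcd (Finset.singleton_injective e)
      rw [Finset.card_insert_of_notMem n1, Finset.card_insert_of_notMem n2, Finset.card_pair n3]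
    have := Finset.card_le_card hsub
    rw [h4, hdiff] at this
    omega
  subst hcd
  -- the outsiders are exactly `{c}`, `{a, c}`, `{b, c}`
  have hT : F \ P = {{c}, {a, c}, {b, c}} := by
    symm
    apply Finset.eq_of_subset_of_card_le
    · intro t ht
      simp only [Finset.mem_insert, Finset.mem_singleton] at ht
      rcases ht with rfl | rfl | rfl
      · exact hout_sing c hca hcb hcF
      · exact hout_ac
      · exact hout_bd
    · rw [hdiff]
      have n1 : ({c} : Finset (Fin h)) ∉ ({{a, c}, {b, c}} : Finset (Finset (Fin h))) := by
        simp only [Finset.mem_insert, Finset.mem_singleton, not_or]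
        refine ⟨fun e => ?_, fun e => ?_⟩
        · have := congrArg Finset.card e
          rw [Finset.card_pair (fun e' => hca e'.symm), Finset.card_singleton] at this; omega
        · have := congrArg Finset.card e
          rw [Finset.card_pair (fun e' => hcb e'.symm), Finset.card_singleton] at this; omega
      have n2 : ({a, c} : Finset (Fin h)) ≠ {b, c} := by
        intro e
        have : a ∈ ({b, c} : Finset (Fin h)) := by rw [← e]; simp
        simp only [Finset.mem_insert, Finset.mem_singleton] at this
        rcases this with e' | e'
        · exact hab e'
        · exact hca e'.symm
      rw [Finset.card_insert_of_notMem n1, Finset.card_pair n2]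
  refine ⟨a, b, c, hab, fun e => hca e.symm, fun e => hcb e.symm, fun y hy => ?_⟩
  by_cases hyP : y ∈ P
  · rcases (hPmem y).mp hyP with e | e | e | e
    · exact Or.inl e
    · exact Or.inr (Or.inl e)
    · exact Or.inr (Or.inr (Or.inl e))
    · exact Or.inr (Or.inr (Or.inr (Or.inr (Or.inl e))))
  · have hyT : y ∈ F \ P := Finset.mem_sdiff.mpr ⟨hy, hyP⟩
    rw [hT] at hyT
    simp only [Finset.mem_insert, Finset.mem_singleton] at hyT
    rcases hyT with e | e | e
    · exact Or.inr (Or.inr (Or.inr (Or.inl e)))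
    · exact Or.inr (Or.inr (Or.inr (Or.inr (Or.inr (Or.inl e)))))
    · exact Or.inr (Or.inr (Or.inr (Or.inr (Or.inr (Or.inr e)))))

end Summit.ValiantsHypothesis.ValiantsHypothesis.Theorems.BarrierLever.FiniteCheck
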